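import Summits.HodgeConjecture.HodgeConjecture.Theses.DworkReflectionQuotients
import Literature.AlgebraicGeometry.HodgeTheory.DworkSexticTopCharacter

/-!
# Item `TypeOneHodge` (child 2 of crux K2, route `DworkReflectionQuotients`) reduced to the Fermat sextic fourfold

Route `route-HodgeConjecture-DworkReflectionQuotients` (cell `hodge-nonav`, rung F-H1 — never summit
credit), item `stmt-HodgeConjecture-21152` `TypeOneHodge` (child 2 of the split of crux K2, stmt-20241):
for `ψ⁶ ≠ 1` and `σ ∈ 𝔖₆` the eigenclasses of `H⁴(X_ψ(ℂ); ℂ)` of Katz's flat type `(1,2,2,3,5,5) ∘ σ`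
and of its conjugate are of Hodge type `(2,2)`. Prover seat `hodge-nonav-20241-p1` (g4), 2026-08-27;
landed `--supports stmt-HodgeConjecture-21152`. CONDITIONAL results — the item is NOT closed here; it is
reduced to statements about the FERMAT point `ψ = 0` alone, using child 1 (`TopCharacterTrivial`, now
the theorem `DworkSextic.topCharacter_trivial`), the tree's `Γ_W`-equivariant transport along the Dwork
line and the Hodge–Riemann sign argument (`DworkSextic.isOfHodgeType_two_two_typeOne_of_fermat`):

* `typeOneHodge_of_fermatTypeOne` — `TypeOneHodge` from the purity `(2,2)` of the `Γ_W`-pieces of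
  `χ_{(1,2,2,3,5,5)∘σ}` and `χ_{(5,4,4,3,1,1)∘σ}` in `H⁴(X⁴₆(ℂ); ℂ)` (the planner's `TypeOneFermatPure`);
* `typeOneHodge_of_fermatClaims` — `TypeOneHodge` from FOUR explicit statements `claim(α)`
  (`FermatCharacter.Claim 6 2 α`: the torus line `V(α) ⊂ H⁴(X⁴₆(ℂ); ℂ)` is spanned by classes of algebraic
  `2`-cycles) for `α = (1,2,2,3,5,5), (3,4,4,5,1,1), (5,4,4,3,1,1), (3,2,2,1,5,5)` — the totally nonzero
  translates of the type and of its conjugate (`DworkSextic.isOfHodgeType_two_two_typeOne_of_claims`);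
* `typeOneHodge_of_shioda` — `TypeOneHodge` modulo the named fact `Shioda1979_claim_semiDecomposable`
  (Shioda 1979 PJA §1 (iii), §4 / Ran 1980 §4: semi-decomposable Hodge characters of `X⁴ₘ` are spanned by
  algebraic cycles; the four `α` are `{1,2,3} ⊔ {2,5,5}`, `{3,4,5} ⊔ {4,1,1}` and negatives).

## References

* N. M. Katz, *Another look at the Dwork family*, Progr. Math. 270 (2009), §3, Lemma 3.1. [Katz2009]
* T. Shioda, *The Hodge conjecture and the Tate conjecture for Fermat varieties*, Proc. Japan Acad. 55A
  (1979), §1 (iii), §4. [Shioda1979PJA]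
* Z. Ran, *Cycles on Fermat hypersurfaces*, Compositio Math. 42 (1980), §4 Cor. 4.7. [Ran1980]
* C. Voisin, *Hodge Theory and Complex Algebraic Geometry I* (2002), §6.3.2 Thm. 6.32. [VoisinHodgeI2002]
-/

namespace Summit.HodgeConjecture.HodgeConjecture.Theorems

open Literature.AlgebraicGeometry.HodgeTheory Literature.AlgebraicGeometry.Motives

/-- **`TypeOneHodge` from the Fermat sextic fourfold**: if for every `σ ∈ 𝔖₆` and every Hodge model
`A₀` of `X⁴₆` the `Γ_W`-eigenspaces of `χ_{(1,2,2,3,5,5)∘σ}` and `χ_{(5,4,4,3,1,1)∘σ}` in `H⁴(X⁴₆(ℂ); ℂ)`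
pull back into `H^{2,2}_{A₀}`, then `TypeOneHodge` holds (`DworkSextic.isOfHodgeType_two_two_typeOne_of_fermat`:
transport + Hodge–Riemann + the trivial top character). CONDITIONAL on the displayed hypothesis only
(no named fact). [cite: Katz2009, Lemma 3.1] [cite: VoisinHodgeI2002, §6.3.2 Thm. 6.32] -/
theorem typeOneHodge_of_fermatTypeOne
    (hF1 : ∀ (σ : Equiv.Perm (Fin 6)) (A₀ : HodgeModel 4 (fermatHypersurface 4 6)),
      (∀ c ∈ diagonalCharacterEigenspace (fermatPolynomial ℂ 4 6) DworkSextic.gammaW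
        (DworkSextic.character fun l => DworkSextic.flatTypes 1 (σ l)) (2 * 2),
          A₀.pullback (2 * 2) c ∈ A₀.hodgePQ (2 * 2) 2 2) ∧
      (∀ c ∈ diagonalCharacterEigenspace (fermatPolynomial ℂ 4 6) DworkSextic.gammaW
        (DworkSextic.character fun l => 6 - DworkSextic.flatTypes 1 (σ l)) (2 * 2),
          A₀.pullback (2 * 2) c ∈ A₀.hodgePQ (2 * 2) 2 2)) :
    Summit.HodgeConjecture.HodgeConjecture.Theses.DworkReflectionQuotients.TypeOneHodge :=
  fun _ hψ σ _ _ hu hv => DworkSextic.isOfHodgeType_two_two_typeOne_of_fermat hψ σ (hF1 σ) hu hv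

/-- **`TypeOneHodge` from four explicit algebraic-cycle statements on the Fermat sextic fourfold**: if
the torus eigenlines `V(1,2,2,3,5,5)`, `V(3,4,4,5,1,1)`, `V(5,4,4,3,1,1)`, `V(3,2,2,1,5,5)` of
`H⁴(X⁴₆(ℂ); ℂ)` lie in the `ℂ`-span of the classes of algebraic `2`-cycles, then `TypeOneHodge` holds
(`DworkSextic.isOfHodgeType_two_two_typeOne_of_claims`: algebraic classes are `(2,2)`, the `Γ_W`-pieces
at the Fermat point are sums of these lines, and purity is transported along the Dwork line).
CONDITIONAL on the four displayed claims only (no named fact) — the sharpest residual form of the item.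
[cite: Katz2009, Lemma 3.1] [cite: Shioda1979PJA, §4] -/
theorem typeOneHodge_of_fermatClaims
    (h₁ : FermatCharacter.Claim 6 2 ![1, 2, 2, 3, 5, 5]) (h₂ : FermatCharacter.Claim 6 2 ![3, 4, 4, 5, 1, 1])
    (h₃ : FermatCharacter.Claim 6 2 ![5, 4, 4, 3, 1, 1]) (h₄ : FermatCharacter.Claim 6 2 ![3, 2, 2, 1, 5, 5]) :
    Summit.HodgeConjecture.HodgeConjecture.Theses.DworkReflectionQuotients.TypeOneHodge :=
  fun _ hψ σ _ _ hu hv => DworkSextic.isOfHodgeType_two_two_typeOne_of_claims h₁ h₂ h₃ h₄ hψ σ hu hv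

/-- **`TypeOneHodge` modulo Shioda's theorem on the semi-decomposable Hodge characters of the Fermat
fourfold** (the tree's named fact `Shioda1979_claim_semiDecomposable`; Shioda 1979 PJA §1 (iii), §4 /
Ran 1980 §4 Cor. 4.7), which claims the four lines of `typeOneHodge_of_fermatClaims`
(`DworkSextic.claims_typeOne_of_shioda`). CONDITIONAL on the named fact (a conditional-result).
[cite: Shioda1979PJA, §1 Definition (iii) and §4] [cite: Ran1980, §4 Cor. 4.7] [cite: Katz2009, Lemma 3.1] -/
theorem typeOneHodge_of_shioda (hS : Shioda1979_claim_semiDecomposable) :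
    Summit.HodgeConjecture.HodgeConjecture.Theses.DworkReflectionQuotients.TypeOneHodge :=
  fun _ hψ σ _ _ hu hv => DworkSextic.isOfHodgeType_two_two_typeOne_of_shioda hS hψ σ hu hv

end Summit.HodgeConjecture.HodgeConjecture.Theorems
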